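import Literature.NumberTheory.Sieve.ChenTwin
import Literature.Barriers.Parity.FordMaynardPrimeSievesProofs
import Literature.Computability.Cryptography.HallgrenClassGroupDivisorSums
import Literature.NumberTheory.DiophantineGeometry.SquarefulSumsCountingTools
import HarnessLib

/-!
# Route `ChenParityOracleBLAP` — crux S1 = `HostParityFromBrick` (stmt-Parity-20045): counting tools for the switched host

Support file for the switched half `K1 → K2 → HP2` of S1.  Chen's switched host
`B(x) = {p₁p₂p₃ − 2}` (`Literature.NumberTheory.Sieve.Chen.chenSetB`) is parametrised by SORTED
prime triples, so `t ↦ p₁p₂p₃ − 2` is injective (`prod3_sub_two_injOn`) and sums over `B(x)`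
are sums over triples.  The triples outside the Type-II boxes (the boundary classes) are
controlled by COUNTING: the `ℓ¹`-over-`d` mass of a set `E` of integers is `∑_{e ∈ E} τ(e)`
(`sum_card_filter_dvd_le_sum_card_divisors`), which on a sparse set `E ⊆ [1, X]` is at most
`√#E · √(X (1 + log X)³)` by Cauchy–Schwarz and `∑_{e ≤ X} τ(e)² ≤ X(1 + log X)³`
(`Literature.Computability.Cryptography.Hallgren2005.sum_card_divisors_sq_le`), and on an initial
segment `[1, n]` is `≤ n(1 + log n)`.

References: Chen Jing-run, Sci. Sinica 16 (1973) [ChenSciSinica1973]; M. B. Nathanson, *Additive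
Number Theory: The Classical Bases* (1996), §10.2 (the set `B`) [Nathanson1996].
-/

namespace Summit.Parity.GeneralizedHardyLittlewood.Theorems

open Finset Real

/-! ### Sorted prime triples: injectivity of the product -/

/-- For primes `a ≤ b ≤ c`, the least prime factor of `abc` is `a`. -/
theorem minFac_mul_mul_of_sorted {a b c : ℕ} (ha : a.Prime) (hb : b.Prime) (hc : c.Prime)
    (hab : a ≤ b) (hbc : b ≤ c) : (a * b * c).minFac = a := by
  have hn1 : a * b * c ≠ 1 := by
    have := ha.two_le; have := hb.two_le; have := hc.two_le
    have : 2 * 2 * 2 ≤ a * b * c := by gcongr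
    omega
  have hle : (a * b * c).minFac ≤ a := Nat.minFac_le_of_dvd ha.two_le ⟨b * c, by ring⟩
  have hp : (a * b * c).minFac.Prime := Nat.minFac_prime hn1
  rcases (Nat.Prime.dvd_mul hp).mp (Nat.minFac_dvd (a * b * c)) with h | h
  · rcases (Nat.Prime.dvd_mul hp).mp h with h' | h'
    · exact (Nat.prime_dvd_prime_iff_eq hp ha).mp h'
    · have := (Nat.prime_dvd_prime_iff_eq hp hb).mp h'; omega
  · have := (Nat.prime_dvd_prime_iff_eq hp hc).mp h; omega

/-- `(p₁, p₂, p₃) ↦ p₁p₂p₃` is injective on sorted triples of primes. -/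
theorem prod3_injOn_sorted (S : Finset (ℕ × ℕ × ℕ))
    (hS : ∀ t ∈ S, t.1.Prime ∧ t.2.1.Prime ∧ t.2.2.Prime ∧ t.1 ≤ t.2.1 ∧ t.2.1 ≤ t.2.2) :
    Set.InjOn (fun t : ℕ × ℕ × ℕ => t.1 * t.2.1 * t.2.2) S := by
  intro t ht t' ht' h
  obtain ⟨h1, h2, h3, h12, h23⟩ := hS t ht
  obtain ⟨h1', h2', h3', h12', h23'⟩ := hS t' ht'
  dsimp only at h
  have e1 : t.1 = t'.1 := by
    rw [← minFac_mul_mul_of_sorted h1 h2 h3 h12 h23, ← minFac_mul_mul_of_sorted h1' h2' h3' h12' h23',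
      h]
  have h' : t.2.1 * t.2.2 = t'.2.1 * t'.2.2 := by
    have hh : t.1 * (t.2.1 * t.2.2) = t.1 * (t'.2.1 * t'.2.2) := by
      rw [← mul_assoc, h, e1, mul_assoc]
    exact Nat.eq_of_mul_eq_mul_left h1.pos hh
  have e2 : t.2.1 = t'.2.1 := by
    rw [← Literature.Barriers.Parity.FordMaynard.minFac_mul_eq h2 h3 h23,
      ← Literature.Barriers.Parity.FordMaynard.minFac_mul_eq h2' h3' h23', h']
  have e3 : t.2.2 = t'.2.2 := by
    rw [e2] at h'
    exact Nat.eq_of_mul_eq_mul_left h2'.pos h'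
  exact Prod.ext e1 (Prod.ext e2 e3)

/-- `(p₁, p₂, p₃) ↦ p₁p₂p₃ − 2` is injective on sorted triples of primes (the products are `≥ 8`). -/
theorem prod3_sub_two_injOn (S : Finset (ℕ × ℕ × ℕ))
    (hS : ∀ t ∈ S, t.1.Prime ∧ t.2.1.Prime ∧ t.2.2.Prime ∧ t.1 ≤ t.2.1 ∧ t.2.1 ≤ t.2.2) :
    Set.InjOn (fun t : ℕ × ℕ × ℕ => t.1 * t.2.1 * t.2.2 - 2) S := by
  intro t ht t' ht' h
  have h8 : ∀ u ∈ S, 8 ≤ u.1 * u.2.1 * u.2.2 := by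
    intro u hu
    obtain ⟨h1, h2, h3, -, -⟩ := hS u hu
    have := h1.two_le; have := h2.two_le; have := h3.two_le
    calc 8 = 2 * 2 * 2 := by norm_num
      _ ≤ u.1 * u.2.1 * u.2.2 := by gcongr
  have ha := h8 t ht
  have hb := h8 t' ht'
  dsimp only at h
  exact prod3_injOn_sorted S hS ht ht' (by dsimp only; omega)

/-- The triples of `B(x)` are sorted: `p₁ < y ≤ p₂ ≤ p₃`. -/
theorem chenSetB_triples_sorted (x : ℕ) :
    ∀ t ∈ (Finset.range (x + 3) ×ˢ Finset.range (x + 3) ×ˢ Finset.range (x + 3)).filter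
      (fun t : ℕ × ℕ × ℕ => t.1.Prime ∧ t.2.1.Prime ∧ t.2.2.Prime ∧
        Literature.NumberTheory.Sieve.Chen.twinZ x ≤ t.1 ∧ t.1 < Literature.NumberTheory.Sieve.Chen.twinY x ∧
        Literature.NumberTheory.Sieve.Chen.twinY x ≤ t.2.1 ∧ t.2.1 ≤ t.2.2 ∧ t.1 * t.2.1 * t.2.2 ≤ x + 2),
      t.1.Prime ∧ t.2.1.Prime ∧ t.2.2.Prime ∧ t.1 ≤ t.2.1 ∧ t.2.1 ≤ t.2.2 := by
  intro t ht
  rw [Finset.mem_filter] at ht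
  obtain ⟨-, h1, h2, h3, -, hy, hy', h23, -⟩ := ht
  exact ⟨h1, h2, h3, by omega, h23⟩

/-- **Sums over `B(x)` are sums over its triples**: for any `f`,
`∑_{e ∈ B(x)} f(e) = ∑_{t ∈ T(x)} f(p₁p₂p₃ − 2)` where `T(x)` is the defining set of sorted prime
triples (the parametrisation is injective). -/
theorem sum_chenSetB_eq_sum_triples (x : ℕ) (f : ℕ → ℝ) :
    ∑ e ∈ Literature.NumberTheory.Sieve.Chen.chenSetB x, f e =
      ∑ t ∈ (Finset.range (x + 3) ×ˢ Finset.range (x + 3) ×ˢ Finset.range (x + 3)).filter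
        (fun t : ℕ × ℕ × ℕ => t.1.Prime ∧ t.2.1.Prime ∧ t.2.2.Prime ∧
          Literature.NumberTheory.Sieve.Chen.twinZ x ≤ t.1 ∧ t.1 < Literature.NumberTheory.Sieve.Chen.twinY x ∧
          Literature.NumberTheory.Sieve.Chen.twinY x ≤ t.2.1 ∧ t.2.1 ≤ t.2.2 ∧ t.1 * t.2.1 * t.2.2 ≤ x + 2),
        f (t.1 * t.2.1 * t.2.2 - 2) := by
  rw [Literature.NumberTheory.Sieve.Chen.chenSetB, Finset.sum_image]
  exact prod3_sub_two_injOn _ (chenSetB_triples_sorted x)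

/-! ### The `ℓ¹`-over-`d` mass of a set of integers -/

/-- `#{1 ≤ d ≤ D : d ∣ e} ≤ τ(e)` for `e ≠ 0`. -/
theorem card_Icc_filter_dvd_le_card_divisors {e : ℕ} (he : e ≠ 0) (D : ℕ) :
    #((Finset.Icc 1 D).filter (fun d => d ∣ e)) ≤ e.divisors.card :=
  Finset.card_le_card fun d hd => by
    rw [Finset.mem_filter] at hd
    exact Nat.mem_divisors.mpr ⟨hd.2, he⟩

/-- `∑_{d ≤ D} #{e ∈ E : d ∣ e} = ∑_{e ∈ E} #{d ≤ D : d ∣ e}` (double counting). -/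
theorem sum_card_filter_dvd_eq (E : Finset ℕ) (D : ℕ) :
    ∑ d ∈ Finset.Icc 1 D, (#(E.filter (fun e => d ∣ e)) : ℝ) =
      ∑ e ∈ E, (#((Finset.Icc 1 D).filter (fun d => d ∣ e)) : ℝ) := by
  simp only [Finset.card_filter, Nat.cast_sum, Nat.cast_ite, Nat.cast_one, Nat.cast_zero]
  exact Finset.sum_comm

/-- `∑_{d ≤ D} #{e ∈ E : d ∣ e} ≤ ∑_{e ∈ E} τ(e)` for a set `E` of positive integers. -/
theorem sum_card_filter_dvd_le_sum_card_divisors (E : Finset ℕ) (hE : ∀ e ∈ E, e ≠ 0) (D : ℕ) :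
    ∑ d ∈ Finset.Icc 1 D, (#(E.filter (fun e => d ∣ e)) : ℝ) ≤
      ∑ e ∈ E, (e.divisors.card : ℝ) := by
  rw [sum_card_filter_dvd_eq]
  exact Finset.sum_le_sum fun e he => by
    exact_mod_cast card_Icc_filter_dvd_le_card_divisors (hE e he) D

/-- `∑_{e ≤ X} τ(e)² ≤ X (1 + log X)³` (real form of the tree's bound). -/
theorem sum_card_divisors_sq_le_real (X : ℕ) :
    ∑ e ∈ Finset.Icc 1 X, ((e.divisors.card : ℝ)) ^ 2 ≤ X * (1 + Real.log X) ^ 3 := by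
  have h := Literature.Computability.Cryptography.Hallgren2005.sum_card_divisors_sq_le X
  push_cast at h
  exact h

/-- **Cauchy–Schwarz for the divisor mass of a sparse set**: for `E ⊆ [1, X]`,
`∑_{e ∈ E} τ(e) ≤ √#E · √(X (1 + log X)³)`. -/
theorem sum_card_divisors_le_sqrt {E : Finset ℕ} {X : ℕ} (hE : E ⊆ Finset.Icc 1 X) :
    ∑ e ∈ E, (e.divisors.card : ℝ) ≤ Real.sqrt (#E) * Real.sqrt (X * (1 + Real.log X) ^ 3) := by
  have h1 := Real.sum_mul_le_sqrt_mul_sqrt E (fun _ => (1 : ℝ)) (fun e => (e.divisors.card : ℝ))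
  have h2 : ∑ _i ∈ E, (1 : ℝ) ^ 2 = #E := by simp
  have h3 : ∑ i ∈ E, ((i.divisors.card : ℝ)) ^ 2 ≤ X * (1 + Real.log X) ^ 3 :=
    (Finset.sum_le_sum_of_subset_of_nonneg hE fun _ _ _ => sq_nonneg _).trans
      (sum_card_divisors_sq_le_real X)
  calc ∑ e ∈ E, (e.divisors.card : ℝ) = ∑ e ∈ E, 1 * (e.divisors.card : ℝ) := by simp
    _ ≤ Real.sqrt (∑ _i ∈ E, (1 : ℝ) ^ 2) * Real.sqrt (∑ i ∈ E, ((i.divisors.card : ℝ)) ^ 2) := h1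
    _ ≤ Real.sqrt (#E) * Real.sqrt (X * (1 + Real.log X) ^ 3) := by
        rw [h2]
        gcongr

/-- `∑_{e ∈ E} τ(e) ≤ n (1 + log n)` for `E ⊆ [1, n]` (Dirichlet's bound, crude form). -/
theorem sum_card_divisors_le_of_subset_Icc {E : Finset ℕ} {n : ℕ} (hE : E ⊆ Finset.Icc 1 n) :
    ∑ e ∈ E, (e.divisors.card : ℝ) ≤ n * (1 + Real.log n) :=
  (Finset.sum_le_sum_of_subset_of_nonneg hE fun _ _ _ => Nat.cast_nonneg _).trans
    (Literature.NumberTheory.DiophantineGeometry.SquarefulCount.sum_card_divisors_le n)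

/-! ### Counting triples in the two boundary classes -/

/-- **Triples with `p₂, p₃` close**: in a set `S` of triples of positive integers with
`p₂ ≤ p₃ < ρ p₂` and `p₁ p₂² ≤ X`, `p₁ < y`, the number of triples is at most
`(ρ − 1) X (1 + log y) + y √X` (fibre over `(p₁, p₂)`: at most `(ρ−1)p₂ + 1` values of `p₃`;
then `∑_{p₂ ≤ √(X/p₁)} ((ρ−1)p₂ + 1) ≤ (ρ−1) X/p₁ + √X` and `∑_{p₁ < y} 1/p₁ ≤ 1 + log y`). -/
theorem card_close_triples_le {S : Finset (ℕ × ℕ × ℕ)} {ρ : ℝ} (hρ : 1 ≤ ρ) {X y : ℕ}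
    (hS : ∀ t ∈ S, 1 ≤ t.1 ∧ t.1 < y ∧ 1 ≤ t.2.1 ∧ t.2.1 ≤ t.2.2 ∧ (t.2.2 : ℝ) < ρ * t.2.1 ∧
      t.1 * t.2.1 * t.2.1 ≤ X) :
    (#S : ℝ) ≤ (ρ - 1) * X * (1 + Real.log y) + y * Real.sqrt X := by
  classical
  have hρ1 : (0 : ℝ) ≤ ρ - 1 := by linarith
  -- project to `(p₁, p₂)`
  set f : ℕ × ℕ × ℕ → ℕ × ℕ := fun t => (t.1, t.2.1) with hf
  set Q : Finset (ℕ × ℕ) := (Finset.Ico 1 y ×ˢ Finset.Icc 1 X).filter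
    (fun q => q.1 * q.2 * q.2 ≤ X) with hQ
  have hmaps : ∀ t ∈ S, f t ∈ Q := by
    intro t ht
    obtain ⟨h1, hy, h2, -, -, hX⟩ := hS t ht
    simp only [hQ, hf, Finset.mem_filter, Finset.mem_product, Finset.mem_Ico, Finset.mem_Icc]
    refine ⟨⟨⟨h1, hy⟩, h2, ?_⟩, hX⟩
    calc t.2.1 = 1 * t.2.1 * 1 := by ring
      _ ≤ t.1 * t.2.1 * t.2.1 := by gcongr
      _ ≤ X := hX
  -- fibre bound
  have hfib : ∀ q ∈ Q, (#(S.filter (fun t => f t = q)) : ℝ) ≤ (ρ - 1) * q.2 + 1 := by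
    intro q _
    -- `t ↦ t.2.2` is injective on the fibre and lands in `[q.2, ⌈ρ q.2⌉)`
    have hinj : Set.InjOn (fun t : ℕ × ℕ × ℕ => t.2.2) (S.filter (fun t => f t = q) : Set _) := by
      intro t ht t' ht' h
      simp only [Finset.coe_filter, Set.mem_setOf_eq, hf] at ht ht'
      have e := ht.2.trans ht'.2.symm
      rw [Prod.mk.injEq] at e
      exact Prod.ext e.1 (Prod.ext e.2 h)
    have himg : (S.filter (fun t => f t = q)).image (fun t : ℕ × ℕ × ℕ => t.2.2) ⊆
        Finset.Ico q.2 ⌈ρ * q.2⌉₊ := by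
      intro c hc
      rw [Finset.mem_image] at hc
      obtain ⟨t, ht, rfl⟩ := hc
      simp only [Finset.mem_filter, hf] at ht
      obtain ⟨htS, hq⟩ := ht
      have h2 : t.2.1 = q.2 := congrArg Prod.snd hq
      obtain ⟨-, -, -, h23, hlt, -⟩ := hS t htS
      rw [Finset.mem_Ico]
      refine ⟨h2 ▸ h23, Nat.lt_ceil.mpr ?_⟩
      rw [← h2]; exact hlt
    have hcard := Finset.card_le_card himg
    rw [Finset.card_image_of_injOn hinj, Nat.card_Ico] at hcard
    have hceil : (⌈ρ * q.2⌉₊ : ℝ) < ρ * q.2 + 1 := Nat.ceil_lt_add_one (by positivity)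
    have hsub : ((⌈ρ * q.2⌉₊ - q.2 : ℕ) : ℝ) ≤ (⌈ρ * q.2⌉₊ : ℝ) - q.2 := by
      rcases le_or_gt q.2 ⌈ρ * q.2⌉₊ with h | h
      · rw [Nat.cast_sub h]
      · rw [Nat.sub_eq_zero_of_le h.le, Nat.cast_zero]
        have : (q.2 : ℝ) ≤ ⌈ρ * q.2⌉₊ := by
          calc (q.2 : ℝ) = 1 * q.2 := by ring
            _ ≤ ρ * q.2 := by gcongr
            _ ≤ ⌈ρ * q.2⌉₊ := Nat.le_ceil _
        linarith
    calc (#(S.filter (fun t => f t = q)) : ℝ) ≤ ((⌈ρ * q.2⌉₊ - q.2 : ℕ) : ℝ) := by exact_mod_cast hcard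
      _ ≤ (⌈ρ * q.2⌉₊ : ℝ) - q.2 := hsub
      _ ≤ (ρ - 1) * q.2 + 1 := by linarith
  -- sum over the fibres
  have hsum : (#S : ℝ) = ∑ q ∈ Q, (#(S.filter (fun t => f t = q)) : ℝ) := by
    rw [Finset.card_eq_sum_card_fiberwise hmaps, Nat.cast_sum]
  -- the inner sums over `b = p₂` for fixed `a = p₁`
  have hinner : ∀ a ∈ Finset.Ico 1 y,
      ∑ b ∈ Finset.Icc 1 X, (if a * b * b ≤ X then (ρ - 1) * (b : ℝ) + 1 else 0) ≤
        (ρ - 1) * ((X : ℝ) / a) + Real.sqrt X := by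
    intro a ha
    rw [Finset.mem_Ico] at ha
    set B := Nat.sqrt (X / a) with hB
    have hfilt : ∀ b ∈ Finset.Icc 1 X, a * b * b ≤ X → b ≤ B := by
      intro b _ hb
      rw [hB, Nat.le_sqrt]
      exact (Nat.le_div_iff_mul_le ha.1).mpr (by nlinarith [hb])
    have hBB : (B : ℝ) * B ≤ (X : ℝ) / a := by
      have h1 : B * B ≤ X / a := by rw [← sq]; exact Nat.sqrt_le' (X / a)
      have h2 : ((B * B : ℕ) : ℝ) ≤ ((X / a : ℕ) : ℝ) := by exact_mod_cast h1
      push_cast at h2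
      exact h2.trans Nat.cast_div_le
    have hBs : (B : ℝ) ≤ Real.sqrt X := by
      rw [Real.le_sqrt (Nat.cast_nonneg _) (Nat.cast_nonneg _)]
      calc (B : ℝ) ^ 2 = (B : ℝ) * B := sq _
        _ ≤ (X : ℝ) / a := hBB
        _ ≤ X := div_le_self (Nat.cast_nonneg _) (by exact_mod_cast ha.1)
    have hstep : ∀ b ∈ Finset.Icc 1 X, (if a * b * b ≤ X then (ρ - 1) * (b : ℝ) + 1 else 0) ≤
        (if b ≤ B then (ρ - 1) * (B : ℝ) + 1 else 0) := by
      intro b hb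
      by_cases h1 : a * b * b ≤ X
      · have hbB : b ≤ B := hfilt b hb h1
        have hbB' : (b : ℝ) ≤ B := by exact_mod_cast hbB
        rw [if_pos h1, if_pos hbB]
        nlinarith
      · rw [if_neg h1]
        split_ifs
        · nlinarith
        · exact le_rfl
    have hcardB : (#((Finset.Icc 1 X).filter (fun b => b ≤ B)) : ℝ) ≤ B := by
      have : (Finset.Icc 1 X).filter (fun b => b ≤ B) ⊆ Finset.Icc 1 B := fun b hb => by
        rw [Finset.mem_filter, Finset.mem_Icc] at hb
        rw [Finset.mem_Icc]; exact ⟨hb.1.1, hb.2⟩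
      have h := Finset.card_le_card this
      rw [Nat.card_Icc] at h
      exact_mod_cast (h.trans (by omega))
    calc ∑ b ∈ Finset.Icc 1 X, (if a * b * b ≤ X then (ρ - 1) * (b : ℝ) + 1 else 0)
        ≤ ∑ b ∈ Finset.Icc 1 X, (if b ≤ B then (ρ - 1) * (B : ℝ) + 1 else 0) :=
          Finset.sum_le_sum hstep
      _ = #((Finset.Icc 1 X).filter (fun b => b ≤ B)) * ((ρ - 1) * (B : ℝ) + 1) := by
          rw [← Finset.sum_filter, Finset.sum_const, nsmul_eq_mul]
      _ ≤ B * ((ρ - 1) * (B : ℝ) + 1) := by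
          have h0 : (0 : ℝ) ≤ (ρ - 1) * (B : ℝ) + 1 := by nlinarith
          exact mul_le_mul_of_nonneg_right hcardB h0
      _ = (ρ - 1) * ((B : ℝ) * B) + B := by ring
      _ ≤ (ρ - 1) * ((X : ℝ) / a) + Real.sqrt X := by
          have := mul_le_mul_of_nonneg_left hBB hρ1
          linarith
  have hQsum : ∑ q ∈ Q, ((ρ - 1) * (q.2 : ℝ) + 1) ≤
      ∑ a ∈ Finset.Ico 1 y, ((ρ - 1) * ((X : ℝ) / a) + Real.sqrt X) := by
    rw [hQ, Finset.sum_filter, Finset.sum_product]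
    exact Finset.sum_le_sum hinner
  have hH : ∑ a ∈ Finset.Ico 1 y, (1 : ℝ) / a ≤ 1 + Real.log y := by
    have hsub : Finset.Ico 1 y ⊆ Finset.Icc 1 y := fun a ha => by
      rw [Finset.mem_Ico] at ha; rw [Finset.mem_Icc]; omega
    calc ∑ a ∈ Finset.Ico 1 y, (1 : ℝ) / a ≤ ∑ a ∈ Finset.Icc 1 y, (1 : ℝ) / a :=
          Finset.sum_le_sum_of_subset_of_nonneg hsub fun _ _ _ => by positivity
      _ = ∑ a ∈ Finset.Icc 1 y, ((a : ℝ))⁻¹ := by simp [one_div]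
      _ ≤ 1 + Real.log y := by
          have := harmonic_le_one_add_log y
          rw [harmonic_eq_sum_Icc] at this
          push_cast at this
          exact this
  have hharm : ∑ a ∈ Finset.Ico 1 y, ((ρ - 1) * ((X : ℝ) / a) + Real.sqrt X) ≤
      (ρ - 1) * X * (1 + Real.log y) + y * Real.sqrt X := by
    rw [Finset.sum_add_distrib, Finset.sum_const, Nat.card_Ico, nsmul_eq_mul]
    have h1 : ∑ a ∈ Finset.Ico 1 y, (ρ - 1) * ((X : ℝ) / a) =
        (ρ - 1) * X * ∑ a ∈ Finset.Ico 1 y, (1 : ℝ) / a := by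
      rw [Finset.mul_sum]; refine Finset.sum_congr rfl fun a _ => by ring
    rw [h1]
    have hρ0 : (0 : ℝ) ≤ (ρ - 1) * X := mul_nonneg hρ1 (Nat.cast_nonneg _)
    have hy' : ((y - 1 : ℕ) : ℝ) ≤ y := by exact_mod_cast Nat.sub_le y 1
    have hsq : 0 ≤ Real.sqrt X := Real.sqrt_nonneg _
    have := mul_le_mul_of_nonneg_left hH hρ0
    nlinarith
  calc (#S : ℝ) = ∑ q ∈ Q, (#(S.filter (fun t => f t = q)) : ℝ) := hsum
    _ ≤ ∑ q ∈ Q, ((ρ - 1) * (q.2 : ℝ) + 1) := Finset.sum_le_sum hfib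
    _ ≤ _ := hQsum.trans hharm

/-- **Triples with `p₁p₂p₃` near the top**: if `t ↦ p₁p₂p₃` is injective on `S` and every
product lies in `(L, X]`, then `#S ≤ X − L`. -/
theorem card_top_triples_le {S : Finset (ℕ × ℕ × ℕ)} {L X : ℕ}
    (hinj : Set.InjOn (fun t : ℕ × ℕ × ℕ => t.1 * t.2.1 * t.2.2) S)
    (hS : ∀ t ∈ S, L < t.1 * t.2.1 * t.2.2 ∧ t.1 * t.2.1 * t.2.2 ≤ X) : #S ≤ X - L := by
  have himg : S.image (fun t : ℕ × ℕ × ℕ => t.1 * t.2.1 * t.2.2) ⊆ Finset.Ioc L X := by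
    intro v hv
    rw [Finset.mem_image] at hv
    obtain ⟨t, ht, rfl⟩ := hv
    exact Finset.mem_Ioc.mpr (hS t ht)
  have := Finset.card_le_card himg
  rwa [Finset.card_image_of_injOn hinj, Nat.card_Ioc] at this

end Summit.Parity.GeneralizedHardyLittlewood.Theorems
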